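import Literature.Geometry.Lorentzian.CarterConeRate
import Literature.Geometry.Lorentzian.CarterConeArithmetic
import Literature.Geometry.Lorentzian.KerrTortoiseRadiusSurj
import HarnessLib

/-!
# The barrier of Carter's coefficient in Breitenlohner–Freedman stable sectors reaches the κ-free
# radius `r₊(1 + θ₁/4)`, on AND off the threshold
(namespace `Literature.Geometry.Lorentzian.Kerr`.)

Carter's radial equation `u″ + φu = 0`, `φ = ω² − V∘ρ` (`V = Kerr.sepPotential M a ω m Λ`, `ρ` a tortoise
radius; DRSR arXiv:1402.7034 §5.2.3) on a sub-extremal Kerr exterior, in the threshold cone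
`σ := ω − mω₊` small, in a BF-STABLE sector with margin `θ₁ ∈ (0, 1]`:
`(1 + θ₁)(2r₊ω)² ≤ Λ′ := Λ − 2amω`. The off-threshold companion of
`CarterThresholdBarrier.le_rho_of_forbidden_threshold` / `rPlus_mul_le_of_margin`: from the lower profile
bound `Δ·[Λ′ − (1 + ε)ω²(r + r₊)²] − (1 + ε⁻¹)(r₊² + a²)²σ² ≤ (r² + a²)²(V − ω²)`
(`Kerr.sq_mul_negCoeff_ge_of_cone'`, `ε = θ₁/8`) at the radius `r⋆ = r₊(1 + θ₁/4)`, where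
`Δ ≥ (θ₁r₊/4)²` and `Λ′ − (1 + θ₁/8)ω²(r⋆ + r₊)² ≥ θ₁Λ′/4`, one gets

* `sq_le_sepPotential_far_collar` — `ω² ≤ V(r⋆)` as soon as `2304 M²σ² ≤ θ₁⁴Λ′`;
* `sigma_sq_le_of_cone_margin` — that smallness holds in the cone `|σ| ≤ ε₀ m` (`0 < m`, `M/2 ≤ |a|`)
  once `ε₀ ≤ θ₁²/(384M)` (then `|ω| ≥ m/(16M)`, `Λ′ ≥ 4M²ω² ≥ m²/64`);
* `exists_coeff_nonpos_far_collar`, `le_rho_of_forbidden_eq_Icc` — along a tortoise radius: there is a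
  point `s⋆` with `φ(s⋆) ≤ 0` and `ρ s⋆ ≥ r₊ + θ₁M/4`, so the forbidden set is NON-EMPTY and, whenever it
  is an interval `[b₁, b₂]`, its far end satisfies `ρ b₂ ≥ r₊ + θ₁M/4` — a κ-FREE distance from the
  horizon (the far-start input `ζ = θ₁M/4` of `carter_envelope_I(_deriv)_of_far_start` and the `hbar`
  input of `Kerr.carter_kernel_le_of_deep_barrier`).

Pure algebra plus the surjectivity of `ρ`; all proved.

## References
* M. Dafermos, I. Rodnianski, Y. Shlapentokh-Rothman, arXiv:1402.7034 = Ann. of Math. 183 (2016),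
  §§5.2.3, 6.2 (key `DafermosRodnianskiShlapentokhrothman2014`). The algebra is folklore.
-/

noncomputable section

open Set

namespace Literature.Geometry.Lorentzian

namespace Kerr

section FarCollar

variable {M a ω Λ : ℝ} {m : ℤ}

/-- The elementary polynomial inequality behind the far collar: for `0 ≤ θ ≤ 1`,
`(1 + θ/8)(2 + θ/4)² ≤ 4(1 + θ)(1 − θ/4)`. [folklore] -/
theorem farCollar_poly_le {θ : ℝ} (h0 : 0 ≤ θ) (h1 : θ ≤ 1) :
    (1 + θ / 8) * (2 + θ / 4) ^ 2 ≤ 4 * (1 + θ) * (1 - θ / 4) := by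
  nlinarith [mul_nonneg h0 h0, mul_nonneg (mul_nonneg h0 h0) h0, mul_nonneg h0 (sub_nonneg.2 h1)]

/-- **`V(r⋆) ≥ ω²` at `r⋆ = r₊(1 + θ₁/4)` in a BF-stable sector.** For `|a| < M`, `0 < θ₁ ≤ 1`, the
margin `(1 + θ₁)(2r₊ω)² ≤ Λ′` (`Λ′ = Λ − 2amω`) and `2304 M²σ² ≤ θ₁⁴Λ′` (`σ = ω − mω₊`):
`ω² ≤ V(r₊(1 + θ₁/4))`. [folklore] -/
theorem sq_le_sepPotential_far_collar (ha : |a| < M) {θ₁ : ℝ} (hθ₁ : 0 < θ₁) (hθ₁1 : θ₁ ≤ 1)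
    (hmargin : (1 + θ₁) * (2 * rPlus M a * ω) ^ 2 ≤ Λ - 2 * a * m * ω)
    (hσ : 2304 * M ^ 2 * (ω - m * horizonAngularVelocity M a) ^ 2 ≤ θ₁ ^ 4 * (Λ - 2 * a * m * ω)) :
    ω ^ 2 ≤ sepPotential M a ω m Λ (rPlus M a * (1 + θ₁ / 4)) := by
  have hM : 0 < M := lt_of_le_of_lt (abs_nonneg a) ha
  have haM : |a| ≤ M := ha.le
  set rp := rPlus M a with hrp
  set Λ' := Λ - 2 * a * m * ω with hΛ'
  set σ := ω - m * horizonAngularVelocity M a with hσdef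
  set r := rp * (1 + θ₁ / 4) with hr
  have hrpM : M ≤ rp := M_le_rPlus M a
  have hrp0 : 0 < rp := hM.trans_le hrpM
  have hrr : rp < r := by
    rw [hr]; nlinarith
  have hΛ'0 : 0 ≤ Λ' := le_trans (by positivity) hmargin
  -- the profile lower bound at `r` with `ε = θ₁/8`
  have hε : 0 < θ₁ / 8 := by positivity
  have key := sq_mul_negCoeff_ge_of_cone' (ω := ω) (Λ := Λ) (m := m) ha hε hrr
  -- `Δ(r) ≥ (θ₁ rp/4)²`
  have hΔ : (θ₁ * rp / 4) ^ 2 ≤ delta M a r := by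
    rw [delta_eq_mul haM r]
    have h1 : r - rp = θ₁ * rp / 4 := by rw [hr]; ring
    have h2 : r - rp ≤ r - rMinus M a := by linarith [rMinus_le_rPlus M a]
    have h3 : 0 ≤ r - rp := by rw [h1]; positivity
    calc (θ₁ * rp / 4) ^ 2 = (r - rp) * (r - rp) := by rw [← h1, sq]
      _ ≤ (r - rPlus M a) * (r - rMinus M a) := mul_le_mul_of_nonneg_left h2 h3
  -- the bracket: `Λ′ − (1 + θ₁/8)ω²(r + rp)² ≥ θ₁Λ′/4`
  have hbr : θ₁ / 4 * Λ' ≤ Λ' - (1 + θ₁ / 8) * (ω ^ 2 * (r + rp) ^ 2) := by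
    have e1 : (r + rp) ^ 2 = (2 + θ₁ / 4) ^ 2 * rp ^ 2 := by rw [hr]; ring
    have hω : 4 * (1 + θ₁) * (ω ^ 2 * rp ^ 2) ≤ Λ' := by
      calc 4 * (1 + θ₁) * (ω ^ 2 * rp ^ 2) = (1 + θ₁) * (2 * rp * ω) ^ 2 := by ring
        _ ≤ Λ' := hmargin
    have hpoly := farCollar_poly_le hθ₁.le hθ₁1
    have h0 : 0 ≤ ω ^ 2 * rp ^ 2 := by positivity
    -- `(1 + θ₁/8)(2 + θ₁/4)² ω²rp² ≤ (1 − θ₁/4)·4(1+θ₁)ω²rp² ≤ (1 − θ₁/4)Λ′`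
    have h1 : (1 + θ₁ / 8) * (ω ^ 2 * (r + rp) ^ 2) ≤ (1 - θ₁ / 4) * Λ' := by
      rw [e1]
      calc (1 + θ₁ / 8) * (ω ^ 2 * ((2 + θ₁ / 4) ^ 2 * rp ^ 2))
          = ((1 + θ₁ / 8) * (2 + θ₁ / 4) ^ 2) * (ω ^ 2 * rp ^ 2) := by ring
        _ ≤ (4 * (1 + θ₁) * (1 - θ₁ / 4)) * (ω ^ 2 * rp ^ 2) := mul_le_mul_of_nonneg_right hpoly h0
        _ = (1 - θ₁ / 4) * (4 * (1 + θ₁) * (ω ^ 2 * rp ^ 2)) := by ring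
        _ ≤ (1 - θ₁ / 4) * Λ' := mul_le_mul_of_nonneg_left hω (by linarith)
    linarith
  -- the `σ²`-term: `(1 + 8/θ₁)(rp² + a²)²σ² ≤ (9/θ₁)·4M²rp²σ²`
  have hA : rp ^ 2 + a ^ 2 = 2 * M * rp := rPlus_sq_add_sq haM
  have hσterm : (1 + (θ₁ / 8)⁻¹) * ((rp ^ 2 + a ^ 2) * σ) ^ 2 ≤ 9 / θ₁ * (4 * M ^ 2 * rp ^ 2 * σ ^ 2) := by
    rw [hA]
    have h1 : (1 + (θ₁ / 8)⁻¹) ≤ 9 / θ₁ := by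
      rw [inv_div, show (1 : ℝ) + 8 / θ₁ = (θ₁ + 8) / θ₁ by field_simp]
      exact div_le_div_of_nonneg_right (by linarith) hθ₁.le
    have h2 : (2 * M * rp * σ) ^ 2 = 4 * M ^ 2 * rp ^ 2 * σ ^ 2 := by ring
    rw [h2]
    exact mul_le_mul_of_nonneg_right h1 (by positivity)
  -- assemble: the lower bound is non-negative
  have hLB : 0 ≤ delta M a r * (Λ' - (1 + θ₁ / 8) * (ω ^ 2 * (r + rp) ^ 2)) -
      (1 + (θ₁ / 8)⁻¹) * ((rp ^ 2 + a ^ 2) * σ) ^ 2 := by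
    have h1 : (θ₁ * rp / 4) ^ 2 * (θ₁ / 4 * Λ') ≤
        delta M a r * (Λ' - (1 + θ₁ / 8) * (ω ^ 2 * (r + rp) ^ 2)) :=
      mul_le_mul hΔ hbr (by positivity) (delta_nonneg haM hrr.le)
    have h2 : 9 / θ₁ * (4 * M ^ 2 * rp ^ 2 * σ ^ 2) ≤ (θ₁ * rp / 4) ^ 2 * (θ₁ / 4 * Λ') := by
      -- `36 M²rp²σ²/θ₁ ≤ θ₁³rp²Λ′/64` iff `2304 M²σ² ≤ θ₁⁴Λ′`
      rw [div_mul_eq_mul_div, div_le_iff₀ hθ₁]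
      have : 9 * (4 * M ^ 2 * rp ^ 2 * σ ^ 2) * 64 ≤ (θ₁ * rp / 4) ^ 2 * (θ₁ / 4 * Λ') * θ₁ * 64 := by
        calc 9 * (4 * M ^ 2 * rp ^ 2 * σ ^ 2) * 64 = rp ^ 2 * (2304 * M ^ 2 * σ ^ 2) := by ring
          _ ≤ rp ^ 2 * (θ₁ ^ 4 * Λ') := mul_le_mul_of_nonneg_left hσ (sq_nonneg _)
          _ = (θ₁ * rp / 4) ^ 2 * (θ₁ / 4 * Λ') * θ₁ * 64 := by ring
      linarith
    linarith
  -- conclude: `(r² + a²)²(V − ω²) ≥ 0` with `(r² + a²)² > 0`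
  have hpos : 0 < (r ^ 2 + a ^ 2) ^ 2 := by
    have : 0 < r := hrp0.trans hrr
    positivity
  have h := hLB.trans key
  have : 0 ≤ sepPotential M a ω m Λ r - ω ^ 2 := by
    by_contra hcon
    push Not at hcon
    have : (r ^ 2 + a ^ 2) ^ 2 * (sepPotential M a ω m Λ r - ω ^ 2) < 0 := mul_neg_of_pos_of_neg hpos hcon
    linarith
  linarith

/-- **The smallness `2304 M²σ² ≤ θ₁⁴Λ′` in the cone.** For `0 < M`, `M/2 ≤ |a|`, `0 < m`,
`|ω − mω₊| ≤ ε₀ m` with `ε₀ ≤ θ₁²/(384M)`, `0 < θ₁ ≤ 1`, and the margin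
`(1 + θ₁)(2r₊ω)² ≤ Λ′`: `2304 M²σ² ≤ θ₁⁴Λ′` (`|ω| ≥ m/(16M)`, `Λ′ ≥ 4M²ω² ≥ m²/64`, `σ² ≤ ε₀²m²`).
[folklore] -/
theorem sigma_sq_le_of_cone_margin (hM : 0 < M) (ha2 : M / 2 ≤ |a|) (hm : 0 < m)
    {ε₀ θ₁ : ℝ} (hθ₁ : 0 < θ₁) (hθ₁1 : θ₁ ≤ 1) (hεθ : ε₀ ≤ θ₁ ^ 2 / (384 * M))
    (hcone : |ω - m * horizonAngularVelocity M a| ≤ ε₀ * |(m : ℝ)|)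
    (hmargin : (1 + θ₁) * (2 * rPlus M a * ω) ^ 2 ≤ Λ - 2 * a * m * ω) :
    2304 * M ^ 2 * (ω - m * horizonAngularVelocity M a) ^ 2 ≤ θ₁ ^ 4 * (Λ - 2 * a * m * ω) := by
  set σ := ω - m * horizonAngularVelocity M a with hσdef
  set Λ' := Λ - 2 * a * m * ω with hΛ'
  have hm1 : (1 : ℝ) ≤ m := by exact_mod_cast hm
  have hmabs : |(m : ℝ)| = m := abs_of_pos (by linarith)
  rw [hmabs] at hcone
  have hrpM : M ≤ rPlus M a := M_le_rPlus M a
  -- `ε₀ ≤ 1/(16M)`, hence `|ω| ≥ m/(16M)`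
  have hε16 : ε₀ ≤ 1 / (16 * M) := by
    calc ε₀ ≤ θ₁ ^ 2 / (384 * M) := hεθ
      _ ≤ 1 / (384 * M) := by
          apply div_le_div_of_nonneg_right _ (by positivity)
          nlinarith
      _ ≤ 1 / (16 * M) := by
          rw [div_le_div_iff₀ (by positivity) (by positivity)]; nlinarith
  have hΩ := le_abs_horizonAngularVelocity hM ha2
  have hωlow : m / (16 * M) ≤ |ω| := by
    have h1 : |(m : ℝ) * horizonAngularVelocity M a| ≥ m * (1 / (8 * M)) := by
      rw [abs_mul, hmabs]; exact mul_le_mul_of_nonneg_left hΩ (by linarith)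
    have h2 : |(m : ℝ) * horizonAngularVelocity M a| - |σ| ≤ |ω| := by
      have := abs_sub_abs_le_abs_sub ((m : ℝ) * horizonAngularVelocity M a) ω
      rw [abs_sub_comm] at this
      linarith
    have h3 : |σ| ≤ m * (1 / (16 * M)) := hcone.trans (by nlinarith)
    have e : (m : ℝ) / (16 * M) = m * (1 / (8 * M)) - m * (1 / (16 * M)) := by field_simp; ring
    rw [e]; linarith
  -- `Λ′ ≥ 4M²ω² ≥ m²/64`
  have hΛ'm : (m : ℝ) ^ 2 / 64 ≤ Λ' := by
    have h1 : 4 * M ^ 2 * ω ^ 2 ≤ Λ' := by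
      calc 4 * M ^ 2 * ω ^ 2 ≤ 4 * rPlus M a ^ 2 * ω ^ 2 := by gcongr
        _ = 1 * (2 * rPlus M a * ω) ^ 2 := by ring
        _ ≤ (1 + θ₁) * (2 * rPlus M a * ω) ^ 2 := by gcongr; linarith
        _ ≤ Λ' := hmargin
    have h2 : (m / (16 * M)) ^ 2 ≤ ω ^ 2 := by
      rw [← sq_abs ω]; exact pow_le_pow_left₀ (by positivity) hωlow 2
    have e : 4 * M ^ 2 * (m / (16 * M)) ^ 2 = (m : ℝ) ^ 2 / 64 := by field_simp; ring
    nlinarith [h2, e]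
  -- `σ² ≤ ε₀²m² ≤ θ₁⁴ m²/(384M)²`
  have hσ2 : σ ^ 2 ≤ (θ₁ ^ 2 / (384 * M)) ^ 2 * (m : ℝ) ^ 2 := by
    have h1 : |σ| ≤ θ₁ ^ 2 / (384 * M) * m := hcone.trans (mul_le_mul_of_nonneg_right hεθ (by linarith))
    have h2 : σ ^ 2 ≤ (θ₁ ^ 2 / (384 * M) * m) ^ 2 := by
      rw [← sq_abs σ]; exact pow_le_pow_left₀ (abs_nonneg _) h1 2
    calc σ ^ 2 ≤ (θ₁ ^ 2 / (384 * M) * m) ^ 2 := h2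
      _ = (θ₁ ^ 2 / (384 * M)) ^ 2 * (m : ℝ) ^ 2 := by ring
  calc 2304 * M ^ 2 * σ ^ 2 ≤ 2304 * M ^ 2 * ((θ₁ ^ 2 / (384 * M)) ^ 2 * (m : ℝ) ^ 2) := by gcongr
    _ = θ₁ ^ 4 * ((m : ℝ) ^ 2 / 64) := by field_simp; ring
    _ ≤ θ₁ ^ 4 * Λ' := mul_le_mul_of_nonneg_left hΛ'm (by positivity)

variable {ρ : ℝ → ℝ}

/-- **A forbidden point at a κ-free distance from the horizon.** Along a tortoise radius `ρ` of a
sub-extremal exterior, under the hypotheses of `sq_le_sepPotential_far_collar` there is `s⋆` with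
`ω² − V(ρ s⋆) ≤ 0` and `r₊ + θ₁M/4 ≤ ρ s⋆` (`ρ s⋆ = r₊(1 + θ₁/4)`, `r₊ ≥ M`). [folklore] -/
theorem exists_coeff_nonpos_far_collar (hρ : IsTortoiseRadius M a ρ) (hMa : IsSubextremal M a)
    {θ₁ : ℝ} (hθ₁ : 0 < θ₁) (hθ₁1 : θ₁ ≤ 1)
    (hmargin : (1 + θ₁) * (2 * rPlus M a * ω) ^ 2 ≤ Λ - 2 * a * m * ω)
    (hσ : 2304 * M ^ 2 * (ω - m * horizonAngularVelocity M a) ^ 2 ≤ θ₁ ^ 4 * (Λ - 2 * a * m * ω)) :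
    ∃ s, ω ^ 2 - sepPotential M a ω m Λ (ρ s) ≤ 0 ∧ rPlus M a + θ₁ * M / 4 ≤ ρ s := by
  have hM : 0 < M := hMa.pos
  have ha : |a| < M := hMa
  have hrpM : M ≤ rPlus M a := M_le_rPlus M a
  have hrp0 : 0 < rPlus M a := rPlus_pos hM a
  have hgt : rPlus M a < rPlus M a * (1 + θ₁ / 4) := by nlinarith
  obtain ⟨s, hs⟩ := hρ.exists_apply_eq hgt
  refine ⟨s, ?_, ?_⟩
  · rw [hs]; linarith [sq_le_sepPotential_far_collar (ω := ω) (Λ := Λ) (m := m) ha hθ₁ hθ₁1 hmargin hσ]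
  · rw [hs]; nlinarith

/-- **The far end of the forbidden interval is κ-freely away from the horizon.** Under the same
hypotheses, if the forbidden set `{s | ω² − V(ρ s) ≤ 0}` equals `[b₁, b₂]`, then
`r₊ + θ₁M/4 ≤ ρ b₂`. [folklore] -/
theorem le_rho_of_forbidden_eq_Icc (hρ : IsTortoiseRadius M a ρ) (hMa : IsSubextremal M a)
    {θ₁ : ℝ} (hθ₁ : 0 < θ₁) (hθ₁1 : θ₁ ≤ 1)
    (hmargin : (1 + θ₁) * (2 * rPlus M a * ω) ^ 2 ≤ Λ - 2 * a * m * ω)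
    (hσ : 2304 * M ^ 2 * (ω - m * horizonAngularVelocity M a) ^ 2 ≤ θ₁ ^ 4 * (Λ - 2 * a * m * ω))
    {b₁ b₂ : ℝ} (hF : {s | ω ^ 2 - sepPotential M a ω m Λ (ρ s) ≤ 0} = Icc b₁ b₂) :
    rPlus M a + θ₁ * M / 4 ≤ ρ b₂ := by
  obtain ⟨s, hs, hρs⟩ := exists_coeff_nonpos_far_collar hρ hMa hθ₁ hθ₁1 hmargin hσ
  have hsF : s ∈ Icc b₁ b₂ := by
    have : s ∈ {s | ω ^ 2 - sepPotential M a ω m Λ (ρ s) ≤ 0} := hs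
    rwa [hF] at this
  exact hρs.trans ((hρ.strictMono hMa).monotone hsF.2)

end FarCollar

end Kerr

end Literature.Geometry.Lorentzian

end
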